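import Literature.AnabelianGeometry.SemiGraphs.PSCSeparatingCoveringsTwoComponentAffineSturdy
import Literature.AnabelianGeometry.SemiGraphs.PSCSeparatingCoveringsProofs2
import Literature.AnabelianGeometry.SemiGraphs.PSCTwoComponentAffineGraphicOrigin
import HarnessLib

/-!
# [CombGC] Prop. 1.2 (i)(ii) IN FULL — sturdy `Π^unr`-clauses included — at every genuine two-component affine datum

Mochizuki, *A combinatorial version of the Grothendieck conjecture*, Tohoku Math. J. **59** (2007)
[CombGC], Proposition 1.2, author's manuscript p. 8 [cite: MochizukiCombGC2007, Prop 1.2 pp.8-9]: (i) "if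
`A₁ ∩ A₂` is open in `A₁` then `v₁ = v₂`" (verticial, edge-like and — "under the further assumption that `G`
is sturdy" — unramified-verticial subgroups `Bᵢ ⊆ Π^unr_G`); (ii) "the `Aᵢ` are commensurably terminal in
`Π_G`; … the `Bᵢ` are commensurably terminal in `Π^unr_G`".  abc-iut FACT-LIST rows F-0459
`PSCDatum.OpenInterDeterminesComponentHolds` and F-0438 `PSCDatum.CommensurableTerminalityHolds` (schemata
over the origin parameter `Ω : PSCOrigin` typed by abc-iut-L3-t4 in `PSCGraphicity.lean`; universal closures
refuted, instance forms at genuine carriers are the content).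

PROOF-ONLY assembly file (abc-iut-f-164 gen 4).  Gen 3 of this seat proved, at EVERY datum of two-component
AFFINE shape (`PSCTwoComponentAffineShape.lean`: a pointed stable curve `C₀ ∪_ν C₁`, genera `g₀`, `g − g₀`,
`s ≥ 2` marked points on `C₁`, `r − s ≥ 2` on `C₀`; `Π` = ANY profinite pro-`Σ` completion `ι : Γ_{g,r} → Π`),
the first clause of Prop. 1.2 (ii) (`verticialEdgeLikeCommensurablyTerminal_of_twoComponentAffine`) and
recorded the STURDY `Π^unr`-clause (`UnrVerticialCommensurablyTerminal`: commensurable terminality of the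
image of `Π_v` in the free pro-`Σ` product `Π^unr ≅ (Γ_{g₀,0} ∗ Γ_{g−g₀,0})^Σ`) as HONEST-OPEN.  It is closed
here by composing two theorems that landed afterwards / alongside:

* abc-iut-w5-d047's `separatingCoverings_of_twoComponentAffine` (`PSCSeparatingCoveringsTwoComponentAffineSturdy`,
  door D1 of abc-iut-f-166's programme: the verticial, edge-like AND `Π^unr`-verticial separating coverings
  of the PROOF of Prop. 1.2, p. 9, at every two-component affine datum — the `Π^unr` conjunct genuine at
  sturdy data via the fibred twist in `Γ/⟨⟨c_j, ε⟩⟩ ≅ Γ_{g₀,0} ∗ Γ_{g−g₀,0}`);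
* abc-iut-w5-d183's `prop12_of_separating` (`PSCSeparatingCoveringsProofs2`, rows P12-L02/L03: "assertion
  (ii) follows formally from assertion (i)" — `γ' ∈ C_Π(B)` makes `B ∩ γ'Bγ'⁻¹` open in `B`, and the
  separating covering at a level missing `γ'B` forbids that).

Contents:
* `prop12_of_twoComponentAffine` — **all five typed clauses of Prop. 1.2 (i)(ii) at every two-component
  affine datum** (any genera — sturdy included —, any `Σ`, any profinite pro-`Σ` completion);
  `unrVerticialCommensurablyTerminal_of_twoComponentAffine` (the formerly open clause by name) and
  `commensurablyTerminal_of_twoComponentAffine` (Prop. 1.2 (ii), both clauses);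
* `twoComponentAffineOrigin_prop12_rows` — at every origin of two-component affine data (gen 3's origin
  hypothesis, `nodeEnds` recorded; universe `0`, where the separating coverings live):
  `CommensurableTerminalityHolds Ω ∧ OpenInterDeterminesComponentHolds Ω ∧ SeparatingCoveringsHolds Ω`
  (F-0438 in full, F-0459, F-2830) with NO genus restriction — superseding conjunct (5) of gen 3's
  `twoComponentAffineOrigin_rows` ("provided every datum has a component of genus `< 2`");
* `exists_twoComponentAffineOrigin_prop12_holds_all` — capstone: the origin of ALL two-component affine data
  with `Σ = {l}` — inhabited for EVERY splitting `g₀ ≤ g`, `2 ≤ s`, `s + 2 ≤ r`, in particular by STURDY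
  data (e.g. two genus-`2` components over `Γ_{4,4}`) — satisfies F-0438 ∧ F-0459 ∧ F-0440 ∧ F-0443 ∧ F-1931
  ∧ F-0458 ∧ F-2830 (gen 3's `exists_twoComponentAffineOrigin_prop12ii_holds` had to restrict to `g₀ ≤ 1`).
  F-0461 (Thm. 1.6 (iii)) is NOT vacuous at sturdy data and is not treated here.

Instance forms at data of the shape of genuine two-component curves: consistency evidence for the typed
schemata, not the printed theorems for all pointed stable curves (cell FOUNDATIONS rows 13–14).  0
definitions; classical group theory through the cited tree theorems; nothing here takes a side on
[IUTchIII] Cor. 3.12.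
-/

noncomputable section

namespace Literature.AnabelianGeometry.SemiGraphs

open scoped Pointwise
open Literature.GroupTheory.CombinatorialGroupTheory
open Literature.GroupTheory.CombinatorialGroupTheory.PuncturedSurfaceGroup (cuspInertia)
open SemiGraphOfAnabelioids (IsProSigmaCompletion)

namespace PSCDatum

/-! ### Datum level: all five clauses of Prop. 1.2 (i)(ii) -/

section Datum

variable {P : Type} [Group P] [TopologicalSpace P] [IsTopologicalGroup P]
variable [CompactSpace P] [TotallyDisconnectedSpace P] {Sigma : Set ℕ} {g r : ℕ}

/-- **[CombGC] Prop. 1.2 (i) and (ii), ALL typed clauses, at every genuine two-component affine datum**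
(`s ≥ 2` cusps on `C₁`, `r − s ≥ 2` on `C₀`, genera `g₀`, `g − g₀` ARBITRARY — sturdy data included —, any
`Σ`, any profinite pro-`Σ` completion of `Γ_{g,r}`): (i) verticial / edge-like / (sturdy) `Π^unr`-verticial
open intersections determine the component; (ii) verticial and edge-like subgroups are commensurably terminal
in `Π_G`, and (sturdy) unramified verticial subgroups in `Π^unr_G`.  (`prop12_of_separating` applied to
`separatingCoverings_of_twoComponentAffine`.) [cite: MochizukiCombGC2007, Prop 1.2 pp.8-9] -/
theorem prop12_of_twoComponentAffine (hne : Sigma.Nonempty)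
    (hprime : ∀ p ∈ Sigma, p.Prime) (ι : PuncturedSurfaceGroup g r →* P)
    (hι : IsProSigmaCompletion Sigma ι) (G : PSCDatum P) {g₀ s : ℕ} (hs : 2 ≤ s) (hsr : s + 2 ≤ r)
    (e : G.graph.C ≃ Fin r)
    (hC : ∀ c, G.cuspGp c = ((cuspInertia (g := g) (e c)).map ι).topologicalClosure)
    (v₀ v₁ : G.graph.V) (hV : ∀ w, w = v₀ ∨ w = v₁) (n₀ : G.graph.N) (hN : ∀ n, n = n₀)
    (ε : PuncturedSurfaceGroup g r)
    (hε : ε = ((List.finRange r).map fun j : Fin r =>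
          if s ≤ (j : ℕ) then PuncturedSurfaceGroup.c (g := g) j else 1).prod *
        ((List.finRange g).map fun i : Fin g => if (i : ℕ) < g₀ then
          PuncturedSurfaceGroup.a (r := r) i * PuncturedSurfaceGroup.b i *
            (PuncturedSurfaceGroup.a i)⁻¹ * (PuncturedSurfaceGroup.b i)⁻¹ else 1).prod)
    (hV₀ : G.vertGp v₀ = ((Subgroup.closure {x : PuncturedSurfaceGroup g r |
        (∃ i : Fin g, (i : ℕ) < g₀ ∧ (x = PuncturedSurfaceGroup.a i ∨ x = PuncturedSurfaceGroup.b i)) ∨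
        ∃ j : Fin r, s ≤ (j : ℕ) ∧ x = PuncturedSurfaceGroup.c j}).map ι).topologicalClosure)
    (hV₁ : G.vertGp v₁ = ((Subgroup.closure {x : PuncturedSurfaceGroup g r |
        (∃ i : Fin g, g₀ ≤ (i : ℕ) ∧ (x = PuncturedSurfaceGroup.a i ∨ x = PuncturedSurfaceGroup.b i)) ∨
        (∃ j : Fin r, (j : ℕ) < s ∧ x = PuncturedSurfaceGroup.c j) ∨ x = ε}).map ι).topologicalClosure)
    (hE : G.nodeGp n₀ = ((Subgroup.zpowers ε).map ι).topologicalClosure)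
    (hgen₀ : G.genus v₀ = g₀) (hgen₁ : G.genus v₁ = g - g₀) :
    (G.VerticialOpenInterDeterminesVertex ∧ G.EdgeLikeOpenInterDeterminesEdge ∧
      G.UnrVerticialOpenInterDeterminesVertex) ∧
    (G.VerticialEdgeLikeCommensurablyTerminal ∧ G.UnrVerticialCommensurablyTerminal) :=
  G.prop12_of_separating (G.separatingCoverings_of_twoComponentAffine hne hprime ι hι hs hsr e hC v₀ v₁ hV
    n₀ hN ε hε hV₀ hV₁ hE hgen₀ hgen₁)

/-- **[CombGC] Prop. 1.2 (ii), the STURDY `Π^unr`-clause, at every genuine two-component affine datum**: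
"under the further assumption that `G` is sturdy [both genera `≥ 2`], the `Bᵢ` [images of the verticial
subgroups in `Π^unr_G`] are commensurably terminal in `Π^unr_G`" — i.e. `C_Π(γΠ_vγ⁻¹ · Ker(Π ↠ Π^unr)) =
γΠ_vγ⁻¹ · Ker` for both vertices and every `γ`.  The clause recorded HONEST-OPEN by gen 3 of this seat
(`PSCTwoComponentAffineFreeFactors.lean`, "Honest scope"); closed by the `Π^unr`-separating coverings of
abc-iut-w5-d047 / abc-iut-f-166 and abc-iut-w5-d183's formal step (ii) ⇐ (i).
[cite: MochizukiCombGC2007, Prop 1.2(ii) p.8] -/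
theorem unrVerticialCommensurablyTerminal_of_twoComponentAffine (hne : Sigma.Nonempty)
    (hprime : ∀ p ∈ Sigma, p.Prime) (ι : PuncturedSurfaceGroup g r →* P)
    (hι : IsProSigmaCompletion Sigma ι) (G : PSCDatum P) {g₀ s : ℕ} (hs : 2 ≤ s) (hsr : s + 2 ≤ r)
    (e : G.graph.C ≃ Fin r)
    (hC : ∀ c, G.cuspGp c = ((cuspInertia (g := g) (e c)).map ι).topologicalClosure)
    (v₀ v₁ : G.graph.V) (hV : ∀ w, w = v₀ ∨ w = v₁) (n₀ : G.graph.N) (hN : ∀ n, n = n₀)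
    (ε : PuncturedSurfaceGroup g r)
    (hε : ε = ((List.finRange r).map fun j : Fin r =>
          if s ≤ (j : ℕ) then PuncturedSurfaceGroup.c (g := g) j else 1).prod *
        ((List.finRange g).map fun i : Fin g => if (i : ℕ) < g₀ then
          PuncturedSurfaceGroup.a (r := r) i * PuncturedSurfaceGroup.b i *
            (PuncturedSurfaceGroup.a i)⁻¹ * (PuncturedSurfaceGroup.b i)⁻¹ else 1).prod)
    (hV₀ : G.vertGp v₀ = ((Subgroup.closure {x : PuncturedSurfaceGroup g r |
        (∃ i : Fin g, (i : ℕ) < g₀ ∧ (x = PuncturedSurfaceGroup.a i ∨ x = PuncturedSurfaceGroup.b i)) ∨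
        ∃ j : Fin r, s ≤ (j : ℕ) ∧ x = PuncturedSurfaceGroup.c j}).map ι).topologicalClosure)
    (hV₁ : G.vertGp v₁ = ((Subgroup.closure {x : PuncturedSurfaceGroup g r |
        (∃ i : Fin g, g₀ ≤ (i : ℕ) ∧ (x = PuncturedSurfaceGroup.a i ∨ x = PuncturedSurfaceGroup.b i)) ∨
        (∃ j : Fin r, (j : ℕ) < s ∧ x = PuncturedSurfaceGroup.c j) ∨ x = ε}).map ι).topologicalClosure)
    (hE : G.nodeGp n₀ = ((Subgroup.zpowers ε).map ι).topologicalClosure)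
    (hgen₀ : G.genus v₀ = g₀) (hgen₁ : G.genus v₁ = g - g₀) :
    G.UnrVerticialCommensurablyTerminal :=
  (G.prop12_of_twoComponentAffine hne hprime ι hι hs hsr e hC v₀ v₁ hV n₀ hN ε hε hV₀ hV₁ hE hgen₀
    hgen₁).2.2

/-- **[CombGC] Prop. 1.2 (ii), BOTH clauses, at every genuine two-component affine datum** (any genera):
verticial and edge-like subgroups are commensurably terminal in `Π_G` (gen 3, by free factors; re-derived)
AND, for sturdy data, unramified verticial subgroups are commensurably terminal in `Π^unr_G`.
[cite: MochizukiCombGC2007, Prop 1.2(ii) p.8] -/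
theorem commensurablyTerminal_of_twoComponentAffine (hne : Sigma.Nonempty)
    (hprime : ∀ p ∈ Sigma, p.Prime) (ι : PuncturedSurfaceGroup g r →* P)
    (hι : IsProSigmaCompletion Sigma ι) (G : PSCDatum P) {g₀ s : ℕ} (hs : 2 ≤ s) (hsr : s + 2 ≤ r)
    (e : G.graph.C ≃ Fin r)
    (hC : ∀ c, G.cuspGp c = ((cuspInertia (g := g) (e c)).map ι).topologicalClosure)
    (v₀ v₁ : G.graph.V) (hV : ∀ w, w = v₀ ∨ w = v₁) (n₀ : G.graph.N) (hN : ∀ n, n = n₀)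
    (ε : PuncturedSurfaceGroup g r)
    (hε : ε = ((List.finRange r).map fun j : Fin r =>
          if s ≤ (j : ℕ) then PuncturedSurfaceGroup.c (g := g) j else 1).prod *
        ((List.finRange g).map fun i : Fin g => if (i : ℕ) < g₀ then
          PuncturedSurfaceGroup.a (r := r) i * PuncturedSurfaceGroup.b i *
            (PuncturedSurfaceGroup.a i)⁻¹ * (PuncturedSurfaceGroup.b i)⁻¹ else 1).prod)
    (hV₀ : G.vertGp v₀ = ((Subgroup.closure {x : PuncturedSurfaceGroup g r |
        (∃ i : Fin g, (i : ℕ) < g₀ ∧ (x = PuncturedSurfaceGroup.a i ∨ x = PuncturedSurfaceGroup.b i)) ∨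
        ∃ j : Fin r, s ≤ (j : ℕ) ∧ x = PuncturedSurfaceGroup.c j}).map ι).topologicalClosure)
    (hV₁ : G.vertGp v₁ = ((Subgroup.closure {x : PuncturedSurfaceGroup g r |
        (∃ i : Fin g, g₀ ≤ (i : ℕ) ∧ (x = PuncturedSurfaceGroup.a i ∨ x = PuncturedSurfaceGroup.b i)) ∨
        (∃ j : Fin r, (j : ℕ) < s ∧ x = PuncturedSurfaceGroup.c j) ∨ x = ε}).map ι).topologicalClosure)
    (hE : G.nodeGp n₀ = ((Subgroup.zpowers ε).map ι).topologicalClosure)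
    (hgen₀ : G.genus v₀ = g₀) (hgen₁ : G.genus v₁ = g - g₀) :
    G.VerticialEdgeLikeCommensurablyTerminal ∧ G.UnrVerticialCommensurablyTerminal :=
  (G.prop12_of_twoComponentAffine hne hprime ι hι hs hsr e hC v₀ v₁ hV n₀ hN ε hε hV₀ hV₁ hE hgen₀
    hgen₁).2

end Datum

/-! ### Origin level: F-0438 (in full), F-0459, F-2830 at every origin of two-component affine data -/

/-- **F-0438 `CommensurableTerminalityHolds Ω` (BOTH clauses), F-0459 `OpenInterDeterminesComponentHolds Ω`
and F-2830 `SeparatingCoveringsHolds Ω` at EVERY origin of two-component affine data** — gen 3's origin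
hypothesis (shape of `PSCTwoComponentAffineShape.lean` over a profinite pro-`Σ` completion of `Γ_{g,r}` in
`Type`, `nodeEnds` recorded), with NO restriction on the genera: sturdy data are covered.  Supersedes
conjunct (5) of gen 3's `twoComponentAffineOrigin_rows` (there only for origins all of whose data have a
component of genus `< 2`). [cite: MochizukiCombGC2007, Prop 1.2 pp.8-9] -/
theorem twoComponentAffineOrigin_prop12_rows (Ω : PSCOrigin.{0})
    (hΩ : ∀ ⦃Q : Type⦄ [Group Q] [TopologicalSpace Q] (G : PSCDatum Q),
      Ω.IsOfPSCType G → ∃ (_ : IsTopologicalGroup Q), CompactSpace Q ∧ T2Space Q ∧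
        TotallyDisconnectedSpace Q ∧
        ∃ (S : Set ℕ) (g r g₀ s : ℕ) (ι : PuncturedSurfaceGroup g r →* Q) (e : G.graph.C ≃ Fin r)
          (v₀ v₁ : G.graph.V) (n₀ : G.graph.N) (ε : PuncturedSurfaceGroup g r),
          S.Nonempty ∧ (∀ p ∈ S, p.Prime) ∧ IsProSigmaCompletion S ι ∧ g₀ ≤ g ∧ 2 ≤ s ∧ s + 2 ≤ r ∧
          (∀ c, G.cuspGp c =
            ((PuncturedSurfaceGroup.cuspInertia (g := g) (e c)).map ι).topologicalClosure) ∧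
          (∀ w, w = v₀ ∨ w = v₁) ∧ (∀ n, n = n₀) ∧
          ε = ((List.finRange r).map fun j : Fin r =>
            if s ≤ (j : ℕ) then PuncturedSurfaceGroup.c (g := g) j else 1).prod *
          ((List.finRange g).map fun i : Fin g => if (i : ℕ) < g₀ then
            PuncturedSurfaceGroup.a (r := r) i * PuncturedSurfaceGroup.b i *
              (PuncturedSurfaceGroup.a i)⁻¹ * (PuncturedSurfaceGroup.b i)⁻¹ else 1).prod ∧
          G.vertGp v₀ = ((Subgroup.closure {x : PuncturedSurfaceGroup g r |
            (∃ i : Fin g, (i : ℕ) < g₀ ∧ (x = PuncturedSurfaceGroup.a i ∨ x = PuncturedSurfaceGroup.b i)) ∨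
            ∃ j : Fin r, s ≤ (j : ℕ) ∧ x = PuncturedSurfaceGroup.c j}).map ι).topologicalClosure ∧
          G.vertGp v₁ = ((Subgroup.closure {x : PuncturedSurfaceGroup g r |
            (∃ i : Fin g, g₀ ≤ (i : ℕ) ∧ (x = PuncturedSurfaceGroup.a i ∨ x = PuncturedSurfaceGroup.b i)) ∨
            (∃ j : Fin r, (j : ℕ) < s ∧ x = PuncturedSurfaceGroup.c j) ∨ x = ε}).map ι).topologicalClosure ∧
          G.nodeGp n₀ = ((Subgroup.zpowers ε).map ι).topologicalClosure ∧
          G.genus v₀ = g₀ ∧ G.genus v₁ = g - g₀ ∧ (∀ n, G.graph.nodeEnds n = s(v₀, v₁))) :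
    CommensurableTerminalityHolds Ω ∧ OpenInterDeterminesComponentHolds Ω ∧ SeparatingCoveringsHolds Ω := by
  have hsep : SeparatingCoveringsHolds Ω := by
    intro Q _ _ _ G hG
    obtain ⟨_, hc, ht, hd, S, g, r, g₀, s, ι, e, v₀, v₁, n₀, ε, hne, hprime, hι, -, hs, hsr, hC, hV, hN,
      hε, hV₀, hV₁, hE, hgen₀, hgen₁, -⟩ := hΩ G hG
    haveI := hc
    haveI := hd
    exact G.separatingCoverings_of_twoComponentAffine hne hprime ι hι hs hsr e hC v₀ v₁ hV n₀ hN ε hε hV₀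
      hV₁ hE hgen₀ hgen₁
  have hprof : ∀ ⦃Q : Type⦄ [Group Q] [TopologicalSpace Q] [IsTopologicalGroup Q] (G : PSCDatum Q),
      Ω.IsOfPSCType G → CompactSpace Q ∧ TotallyDisconnectedSpace Q := fun Q _ _ _ G hG => by
    obtain ⟨_, hc, -, hd, -⟩ := hΩ G hG
    exact ⟨hc, hd⟩
  exact ⟨commensurableTerminalityHolds_of_separating Ω hsep hprof,
    openInterDeterminesComponentHolds_of_separating Ω hsep hprof, hsep⟩

/-! ### Capstone: the inhabited origin of ALL two-component affine data with `Σ = {l}` -/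

/-- **At the origin of ALL two-component affine data with `Σ = {l}` — inhabited for EVERY splitting
`g₀ ≤ g`, `2 ≤ s`, `s + 2 ≤ r` by the genuine datum over a pro-`l` completion of `Γ_{g,r}`, in particular by
STURDY data (both genera `≥ 2`, e.g. over `Γ_{4,4}`) — F-0438 ([CombGC] Prop. 1.2 (ii), BOTH clauses),
F-0459 (Prop. 1.2 (i), all three clauses), F-0440 (Prop. 1.5 (i)), F-0443 (Prop. 1.5 (ii)), F-1931
([IUTchI] Rmk. 1.2.3 (iv), cuspidal), F-0458 (Thm. 1.6 (i)) and F-2830 (the separating coverings of the proof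
of Prop. 1.2) ALL HOLD.**  Gen 3's `exists_twoComponentAffineOrigin_prop12ii_holds` needed `g₀ ≤ 1` for
F-0438; that restriction is gone.  (F-0461 / Thm. 1.6 (iii) is not vacuous at sturdy data and is not claimed.)
[cite: MochizukiCombGC2007, Prop 1.2 pp.8-9] [cite: MochizukiCombGC2007, Prop 1.5(ii) p.13]
[cite: MochizukiCombGC2007, Thm 1.6(i) p.13] -/
theorem exists_twoComponentAffineOrigin_prop12_holds_all (l : ℕ) (hl : l.Prime) :
    ∃ Ω : PSCOrigin.{0},
      (∀ g r g₀ s : ℕ, g₀ ≤ g → 2 ≤ s → s + 2 ≤ r →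
        ∃ (Q : ProfiniteGrp.{0}) (ι : PuncturedSurfaceGroup g r →* Q) (G : PSCDatum Q),
          IsProSigmaCompletion {l} ι ∧ Ω.IsOfPSCType G ∧ G.Sigma = {l} ∧ G.graph.i = 2 ∧ G.graph.n = 1 ∧
            G.graph.r = r ∧ (∃ v₀ v₁ : G.graph.V, (∀ w, w = v₀ ∨ w = v₁) ∧ G.genus v₀ = g₀ ∧
              G.genus v₁ = g - g₀)) ∧
      (∃ (Q : ProfiniteGrp.{0}) (G : PSCDatum Q), Ω.IsOfPSCType G ∧ G.IsSturdy ∧ G.graph.i = 2 ∧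
        G.graph.n = 1 ∧ G.graph.r = 4) ∧
      CommensurableTerminalityHolds Ω ∧ OpenInterDeterminesComponentHolds Ω ∧ EdgeLikeIncidenceHolds Ω ∧
      GraphicIffEdgeLikeVerticialHolds Ω ∧ CuspidalEdgeLikeCharacterizationHolds Ω ∧
      NumericallyCuspidalIffHolds Ω ∧ SeparatingCoveringsHolds Ω := by
  classical
  let Ω : PSCOrigin.{0} :=
    ⟨fun {Q} _ _ G => G.Sigma = {l} ∧ ∃ (_ : IsTopologicalGroup Q), CompactSpace Q ∧ T2Space Q ∧
      TotallyDisconnectedSpace Q ∧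
      ∃ (S : Set ℕ) (g r g₀ s : ℕ) (ι : PuncturedSurfaceGroup g r →* Q) (e : G.graph.C ≃ Fin r)
        (v₀ v₁ : G.graph.V) (n₀ : G.graph.N) (ε : PuncturedSurfaceGroup g r),
        S.Nonempty ∧ (∀ p ∈ S, p.Prime) ∧ IsProSigmaCompletion S ι ∧ g₀ ≤ g ∧ 2 ≤ s ∧ s + 2 ≤ r ∧
        (∀ c, G.cuspGp c =
          ((PuncturedSurfaceGroup.cuspInertia (g := g) (e c)).map ι).topologicalClosure) ∧
        (∀ w, w = v₀ ∨ w = v₁) ∧ (∀ n, n = n₀) ∧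
        ε = ((List.finRange r).map fun j : Fin r =>
          if s ≤ (j : ℕ) then PuncturedSurfaceGroup.c (g := g) j else 1).prod *
        ((List.finRange g).map fun i : Fin g => if (i : ℕ) < g₀ then
          PuncturedSurfaceGroup.a (r := r) i * PuncturedSurfaceGroup.b i *
            (PuncturedSurfaceGroup.a i)⁻¹ * (PuncturedSurfaceGroup.b i)⁻¹ else 1).prod ∧
        G.vertGp v₀ = ((Subgroup.closure {x : PuncturedSurfaceGroup g r |
          (∃ i : Fin g, (i : ℕ) < g₀ ∧ (x = PuncturedSurfaceGroup.a i ∨ x = PuncturedSurfaceGroup.b i)) ∨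
          ∃ j : Fin r, s ≤ (j : ℕ) ∧ x = PuncturedSurfaceGroup.c j}).map ι).topologicalClosure ∧
        G.vertGp v₁ = ((Subgroup.closure {x : PuncturedSurfaceGroup g r |
          (∃ i : Fin g, g₀ ≤ (i : ℕ) ∧ (x = PuncturedSurfaceGroup.a i ∨ x = PuncturedSurfaceGroup.b i)) ∨
          (∃ j : Fin r, (j : ℕ) < s ∧ x = PuncturedSurfaceGroup.c j) ∨ x = ε}).map ι).topologicalClosure ∧
        G.nodeGp n₀ = ((Subgroup.zpowers ε).map ι).topologicalClosure ∧
        G.genus v₀ = g₀ ∧ G.genus v₁ = g - g₀ ∧ (∀ n, G.graph.nodeEnds n = s(v₀, v₁))⟩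
  have hSig : ∀ ⦃Q : Type⦄ [Group Q] [TopologicalSpace Q] [IsTopologicalGroup Q] (G : PSCDatum Q),
      Ω.IsOfPSCType G → G.Sigma = {l} := fun Q _ _ _ G hG => hG.1
  have hl' : ∀ p ∈ ({l} : Set ℕ), p.Prime := fun p hp => by
    rw [Set.mem_singleton_iff.mp hp]; exact hl
  -- membership of the genuine datum of every splitting
  have hmem : ∀ g r g₀ s : ℕ, g₀ ≤ g → 2 ≤ s → s + 2 ≤ r →
      ∃ (Q : ProfiniteGrp.{0}) (ι : PuncturedSurfaceGroup g r →* Q) (G : PSCDatum Q),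
        IsProSigmaCompletion {l} ι ∧ Ω.IsOfPSCType G ∧ G.Sigma = {l} ∧ G.graph.i = 2 ∧ G.graph.n = 1 ∧
          G.graph.r = r ∧ (∃ v₀ v₁ : G.graph.V, (∀ w, w = v₀ ∨ w = v₁) ∧ G.genus v₀ = g₀ ∧
            G.genus v₁ = g - g₀) := fun g r g₀ s hg₀ hs hsr => by
    obtain ⟨Q, ι, G, e, v₀, v₁, n₀, ε, hι, hS, hi, hn, hr, hC, hV, hN, hε, hV₀, hV₁, hE, hgen₀, hgen₁,
      hends, -⟩ := exists_twoComponentAffineDatum {l} ⟨l, rfl⟩ hl' g r g₀ s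
    exact ⟨Q, ι, G, hι, ⟨hS, inferInstance, inferInstance, inferInstance, inferInstance, {l}, g, r, g₀, s,
      ι, e, v₀, v₁, n₀, ε, ⟨l, rfl⟩, hl', hι, hg₀, hs, hsr, hC, hV, hN, hε, hV₀, hV₁, hE, hgen₀, hgen₁,
      hends⟩, hS, hi, hn, hr, ⟨v₀, v₁, hV, hgen₀, hgen₁⟩⟩
  obtain ⟨h12i, h15i, h15ii, -, -, hΩ₂⟩ := twoComponentAffineOrigin_rows Ω (fun Q _ _ G hG => hG.2)
  obtain ⟨h12ii, -, hsep⟩ := twoComponentAffineOrigin_prop12_rows Ω (fun Q _ _ G hG => hG.2)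
  refine ⟨Ω, hmem, ?_, h12ii, h12i, h15i, h15ii,
    cuspidalEdgeLikeCharacterizationHolds_of_cuspidallyStandard Ω (fun Q _ _ _ G hG => ?_),
    numericallyCuspidalIffHolds_of_twoComponentAffine Ω l hΩ₂ hSig, hsep⟩
  · -- a STURDY member: two genus-2 components over `Γ_{4,4}`, two cusps on each
    obtain ⟨Q, ι, G, hι, hG, hS, hi, hn, hr, v₀, v₁, hV, hgen₀, hgen₁⟩ :=
      hmem 4 4 2 2 (by norm_num) le_rfl le_rfl
    refine ⟨Q, G, hG, fun v => ?_, hi, hn, hr⟩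
    rcases hV v with rfl | rfl
    · rw [hgen₀]
    · rw [hgen₁]
  · obtain ⟨hc, ht, hd, S, g, r, g₀, s, ι, e, v₀, v₁, n₀, ε, hne, hprime, hι, hg₀, hs, hsr, hC, -⟩ :=
      hΩ₂ G hG
    exact ⟨hc, ht, hd, S, g, r, ι, e, hne, hprime,
      by unfold PuncturedSurfaceGroup.IsHyperbolicType; omega, hι, hC⟩

end PSCDatum

end Literature.AnabelianGeometry.SemiGraphs

end
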